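import Summits.AtomisticToContinuum.HydrodynamicLimit.Theses.StiffCollisionalRelaxation
import Summits.AtomisticToContinuum.HydrodynamicLimit.Theses.CollisionIsometryCLT
import Summits.AtomisticToContinuum.HydrodynamicLimit.Theorems.StiffCollisionalRelaxationAprioriBoundsFibreDefs
import Summits.AtomisticToContinuum.HydrodynamicLimit.Theorems.StiffCollisionalRelaxationAprioriBoundsFibreDefsR4
import Summits.AtomisticToContinuum.HydrodynamicLimit.Theorems.SuperextensiveClosureCostTransferInequality
import Literature.Analysis.FunctionSpaces.TorusMollifier
import HarnessLib

/-!
# Line `local-units-on-the-kinetic-box` for the crux `AprioriBounds` (stmt-AtomisticToContinuum-14827) — skeleton r1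
(crux-plan planner-cruxplan-stmt-AtomisticToContinuum-14827-local-units-on-the-k-0, 2026-08-17; idea card
`Cruxes/AprioriBounds/Ideas/local-units-on-the-kinetic-box.md`, ideator 4, round 2; triage r2-1 pass, r2-2 pass)

Crux decl: `Summit.AtomisticToContinuum.HydrodynamicLimit.Theses.StiffCollisionalRelaxation.AprioriBounds` (rank 4)
= `…Theses.CollisionIsometryCLT.AprioriBoundsPreShock` (rank 5), one `Prop` (`AprioriBoundsNegative.aprioriBounds_iff`:
prefix → `PartOneAt ∧ PartTwoAt`).  This skeleton concludes BOTH by name (`AprioriBounds_of`, `AprioriBoundsPreShock_of`).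

## The line in one sentence

Component (i) with `C` FIXED in `N` is SIZE × CONCENTRATION of the time-integrated one-particle tail occupations
`occ_K = ∫₀ᵗ frac_K(Φ_s ·) ds`.  SIZE in the mean is the pre-shock Gaussian-tail item (`FarTailAllAt` ⇐ stmt-14415, stub 2,
shared with the registered line `tail-occupation-variance`).  CONCENTRATION is produced here WITHOUT any non-equilibrium
self-averaging statement: measure every sphere's peculiar speed in the thermal units OF ITS OWN BLOCK
(`|vᵢ − ū(xᵢ)|² ≥ K·θ̄(xᵢ)`, block fields at the fine kinetic filter `(N+1)^{-1/4}`, `locFrac`); inside the kinetic box of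
`GermanoSplitLES.KineticRangeControl` (stmt-9201 at that admissible filter, stub 3) an absolute level `K ≥ 4U²` IS a local
level `K/(4Θ)` (`frac_le_locFrac_of_box`, PROVED), so `occ_K ≤ locOcc_{K/(4Θ)}` on the box; and a SUSTAINED excess of the
local-unit occupation at a FIXED level is claimed super-exponentially rare under the INVARIANT homogeneous hard-sphere Gibbs
law (stub 4 `stub_eqLocalTailSuperExp` = E1_loc, the ONE open equilibrium-only input), which the landed static `L²` budget
`SuperextensiveClosureCost.TransferInequality` (stmt-9512, `P(S)² ≤ e^{C(N+1)}G(S)`) transfers to `P_N → 0` along the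
NON-equilibrium local Gibbs law (`localTailConc_of_superExp`, PROVED here from `transferInequality_proof` and
`tendsto_zero_of_transfer`).  The conversion of local units back to absolute units on the box is PROVED too
(`occupationInProb_of_localTailConc`: caps `boxCaps_of_inBox`, `frac_le_locFrac_of_box` at every `s ≤ t`, monotone lower
integrals, an empty event below `4U²`) and delivers EXACTLY the in-probability occupation profile that the registered line's
dial stub consumes (stub 5 = its `stub_partOne_of_occupation`, shared byte-identically): the two lines differ in ONE producer
(E1_loc + fine box versus `stub_occupationVariance`), with identical imports {9201, 14415}.  Component (ii) is imported
verbatim (stub 1 ⇐ 9201).  Stubs: 1 `cellBounds`, 2 `farTailAll`, 3 `boxFine` (imports), 4 `eqLocalTailSuperExp` (OPEN,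
load-bearing), 5 `partOne_of_occupation` (provable now); everything else in the file is sorry-free.

## Why it answers the round-2 kill question non-circularly (Lines/fibre-deficit-transfer-dead.md §4)

"Which stub supplies bulk tail-fraction concentration at `s > 0`, and why is it not the conjunct?" — stub 4, a statement about
the STATIONARY, reversible, explicit law only (no Euler field, no local Gibbs reference `G_s`, no LLN): neither implied by nor
implying the conjunct or (i); FALSE at `σ = 0` (free flight preserves any velocity SHAPE,
`Literature.Barriers…measurePreserving_freeFlight_idealGasState`), so it genuinely spends `σ²(N+1)^{1/3} → ∞`.  In ABSOLUTE
units the same sustained-excess event is realised at equilibrium by a coherent jet or a warm region at merely exponential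
cost (the card's F2 = STRATEGY-CENSUS S6), which is why every absolute-unit ledger met a conjunct-strength wall; in local
units jets (`ū`) and hot spots (`θ̄`) do not register, and the price of converting back is exactly the box (9201).

## Disproof used (`Cruxes/AprioriBounds/Disproof.lean`, cycle 4, rc 0; no `-- Targets` for this line)
§9e/§9g `aprioriBoundsPreShockAllLambda_false` / `preShock_equilibrium_lambda_lt`: `λ` stays existential and small — it is
produced inside stub 5 by the dial `λ < 1/(4 max(Θ,Θ'))`, and `occupationInProb_of_localTailConc` outputs `Θ' = 8Θ_b`; the landed
witness `expMoment_bounds_not_sufficient` (no EXPECTATION bound gives fixed `C`): the line supplies IN-PROBABILITY control `→ 0` at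
each fixed level (stub 4 + the proved transfer), not expectations; §3d `aprioriBoundsII_false_without_small_sigma`: every prefix stub keeps
`σ < σ₀` (stubs 1–3), stub 4 has its own `σ₀`, the composition takes `σ < 1/2` too; §9c `two_mul_pow_three_lt_of_dilute`
(chamber): never used by the (i)-chain; §7/§8 negative lemmas `AprioriBounds_false_of_PersistentHotSpot/Vacuum` need `t ≥ T` —
all stubs carry `t < T` or are deterministic in `t`; §9d equilibrium rung TRUE: consistent (at constant profiles the transfer
has `O(1)` budget per particle and stub 4 is itself the equilibrium statement).
-/

noncomputable section

open MeasureTheory ProbabilityTheory Filter Set Topology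
open scoped ENNReal

namespace Summit.AtomisticToContinuum.HydrodynamicLimit.Cruxes.AprioriBounds.LocalUnitsOnTheKineticBox

open Literature.MathematicalPhysics.KineticTheory Literature.Analysis.FluidPDE
open Summit.AtomisticToContinuum.HydrodynamicLimit.Theorems.AprioriBoundsNegative (PartOneAt PartTwoAt)
open Summit.AtomisticToContinuum.HydrodynamicLimit.Theorems.VisitLedgerUpscattering (Cfg Flow Flows NiceProfiles)
open Summit.AtomisticToContinuum.HydrodynamicLimit.Theorems.FibreDeficitTransfer

/-! ## §1 Vocabulary: block fields at a kernel, LOCAL THERMAL UNITS, the kinetic box, the fine kernel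

Conventions: block fields are mollified with `χ(y − x)` (the crux's (ii) convention; `GermanoSplitLES.KineticRangeControl`
mollifies with `φ(x − y)`, i.e. it is fed the reflected kernel, exactly as in the landed `partTwo_of_kineticRangeControl`);
the block temperature is KRC's `θ̄ = (2/3)(ē/ρ̄ − |m̄|²/(2ρ̄²))`, so `InBox` is literally KRC's box. -/

variable {N : ℕ}

/-- Block density at `x`: `ρ̄(x) = (N+1)⁻¹ ∑ᵢ χ(xᵢ − x)`. -/
def bρ (χ : T3 → ℝ) (w : Cfg N) (x : T3) : ℝ := empiricalDensityField w (fun y => χ (y - x))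

/-- Block momentum at `x`: `m̄(x) = (N+1)⁻¹ ∑ᵢ χ(xᵢ − x) vᵢ`. -/
def bm (χ : T3 → ℝ) (w : Cfg N) (x : T3) : V3 := empiricalMomentumField w (fun y => χ (y - x))

/-- Block kinetic energy at `x`: `ē(x) = (N+1)⁻¹ ∑ᵢ χ(xᵢ − x) |vᵢ|²/2`. -/
def be (χ : T3 → ℝ) (w : Cfg N) (x : T3) : ℝ := empiricalEnergyField w (fun y => χ (y - x))

/-- Block mean velocity `ū = m̄/ρ̄` (junk `0` when `ρ̄ = 0`; the box excludes that). -/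
def bu (χ : T3 → ℝ) (w : Cfg N) (x : T3) : V3 := (bρ χ w x)⁻¹ • bm χ w x

/-- Block temperature, KRC's formula: `θ̄ = (2/3)(ē/ρ̄ − |m̄|²/(2ρ̄²))`. -/
def bθ (χ : T3 → ℝ) (w : Cfg N) (x : T3) : ℝ :=
  2 / 3 * (be χ w x / bρ χ w x - ‖bm χ w x‖ ^ 2 / (2 * bρ χ w x ^ 2))

/-- LOCAL-UNIT tail fraction at local level `K`: the fraction of spheres whose peculiar kinetic energy, in units of the
block temperature AT THEIR OWN POSITION, is at least `K`:
`locFrac_K(w) = (N+1)⁻¹ #{i | K·θ̄(xᵢ) ≤ |vᵢ − ū(xᵢ)|²}`.  A coherent jet or a hot spot is NOT fast in these units. -/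
def locFrac (χ : T3 → ℝ) (K : ℝ) (w : Cfg N) : ℝ :=
  ((N + 1 : ℕ) : ℝ)⁻¹ * ∑ i, if K * bθ χ w (w i).1 ≤ ‖(w i).2 - bu χ w (w i).1‖ ^ 2 then (1 : ℝ) else 0

/-- The kinetic box at kernel `χ` (KRC's box `{c ≤ ρ̄ ≤ C_ρ, |m̄| ≤ C, ē ≤ C, θ̄ ≥ c}` at every point of the torus). -/
def InBox (χ : T3 → ℝ) (c Cρ C : ℝ) (w : Cfg N) : Prop :=
  ∀ x : T3, c ≤ bρ χ w x ∧ bρ χ w x ≤ Cρ ∧ ‖bm χ w x‖ ≤ C ∧ be χ w x ≤ C ∧ c ≤ bθ χ w x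

/-- Caps on the block mean speed and temperature (consequence of `InBox` with `U = C/c`, `Θ = (2/3)C/c`; stub 5's
bookkeeping). -/
def BoxCaps (χ : T3 → ℝ) (U Θ : ℝ) (w : Cfg N) : Prop :=
  ∀ x : T3, ‖bu χ w x‖ ≤ U ∧ 0 ≤ bθ χ w x ∧ bθ χ w x ≤ Θ

/-- The mean-speed cap of a box `(c, C_ρ, C)`: `U = |C|/c`. -/
def capU (c C : ℝ) : ℝ := |C| / c

/-- The temperature cap of a box `(c, C_ρ, C)`: `Θ_b = (2/3)|C|/c + 1`. -/
def capΘ (c C : ℝ) : ℝ := 2 / 3 * (|C| / c) + 1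

theorem capU_nonneg {c : ℝ} (C : ℝ) (hc : 0 < c) : 0 ≤ capU c C := div_nonneg (abs_nonneg C) hc.le

theorem capΘ_pos {c : ℝ} (C : ℝ) (hc : 0 < c) : 0 < capΘ c C := by
  have : 0 ≤ |C| / c := div_nonneg (abs_nonneg C) hc.le
  unfold capΘ
  linarith

/-- THE FINE KERNEL FAMILY: the tree's torus mollifier at radius `(N+1)^{-1/4}/4`, i.e. filter exponent `γ' = 1/4 ∈ (1/6, 1/3)`
(below the diffusive width `N^{-1/6}` of an entropy-mode pocket, so unresolved hot filaments die in time `N^{1/3−2γ'} → 0`;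
above `N^{-1/3}`, so `(N+1)ℓ³/log(N+2) → ∞` and the filter is ADMISSIBLE for stmt-9201).  Smooth, `≥ 0`, unit mass, supported in
`euclidDist(·,0) < (N+1)^{-1/4}`, height `≤ C(N+1)^{3/4}`, gradient `≤ C(N+1)` — the proof of
`AprioriBoundsNegative.exists_admissibleKernelFamily` with `1/15 ↦ 1/4`. -/
def fineKernel (N : ℕ) : T3 → ℝ :=
  Literature.Analysis.FunctionSpaces.Torus.kernel (((N : ℝ) + 1) ^ (-(1 / 4 : ℝ)) / 4)

/-! ## §2 The typed packages of the line -/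

/-- **E1_loc (`EqLocalTailSuperExp`) — the line's ONE open input, EQUILIBRIUM ONLY.**  Under the invariant homogeneous hard-sphere
Gibbs law `G_N = localGibbsLaw σ 1 0 θe N (Φ N)`, for the kernel family `φ`, every box `(c, C_ρ, C)` with `c > 0` and every
sub-Gaussian envelope exponent `a < 1/2` there is `A` such that for every horizon `t > 0`, every FIXED local level `K > 0` and
every `M`, eventually in `N`:
`G_N{ box on [0,t] ∧ t·A·e^{−aK} < ∫₀ᵗ locFrac_K(Φ_s z) ds } ≤ e^{−M(N+1)}`
(time integral = lower Lebesgue integral `.toReal`, a number in `[0, t]`).  `K` and `t` BEFORE `N`: the level-`K` population is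
EXTENSIVE (`≍ N e^{−K/2}` spheres refreshed `σ²(N+1)^{1/3}t → ∞` times each), the regime in which a SUSTAINED shape excess is a
space-TIME extensive conspiracy of cost `≫ N`; an instantaneous excess costs only `e^{−O(N)}` and is never claimed. -/
def EqLocalTailSuperExp (σ θe : ℝ) (Φ : Flows σ) (φ : ℕ → T3 → ℝ) : Prop :=
  ∀ (c Cρ C : ℝ), 0 < c → ∀ a : ℝ, 0 < a → a < 1 / 2 → ∃ A : ℝ, ∀ (t K : ℝ), 0 < t → 0 < K → ∀ M : ℝ,
    ∀ᶠ N : ℕ in atTop,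
      localGibbsLaw σ (fun _ => 1) (fun _ => 0) (fun _ => θe) N (Φ N)
          {z | (∀ s ∈ Icc 0 t, InBox (φ N) c Cρ C ((Φ N).flow s z)) ∧
            t * A * Real.exp (-(a * K)) <
              (∫⁻ s in Icc 0 t, ENNReal.ofReal (locFrac (φ N) K ((Φ N).flow s z))).toReal} ≤
        ENNReal.ofReal (Real.exp (-(M * ((N : ℝ) + 1))))

/-- **`LocalTailConcAt` — the transferred form along the NON-equilibrium local Gibbs law** (what stub 5 consumes): for the data
`(a₀, u₀, θ₀)`, horizon `t`, kernel family `φ` and box `(c, C_ρ, C)`: for every `a < 1/2` there is `A` with, at every FIXED local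
level `K > 0`, `P_N{ box on [0,t] ∧ t·A·e^{−aK} < ∫₀ᵗ locFrac_K } → 0`. -/
def LocalTailConcAt (σ : ℝ) (a₀ θ₀ : T3 → ℝ) (u₀ : T3 → V3) (Φ : Flows σ) (t : ℝ) (φ : ℕ → T3 → ℝ)
    (c Cρ C : ℝ) : Prop :=
  ∀ a : ℝ, 0 < a → a < 1 / 2 → ∃ A : ℝ, ∀ K : ℝ, 0 < K →
    Tendsto (fun N : ℕ => localGibbsLaw σ a₀ u₀ θ₀ N (Φ N)
        {z | (∀ s ∈ Icc 0 t, InBox (φ N) c Cρ C ((Φ N).flow s z)) ∧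
          t * A * Real.exp (-(a * K)) <
            (∫⁻ s in Icc 0 t, ENNReal.ofReal (locFrac (φ N) K ((Φ N).flow s z))).toReal})
      atTop (𝓝 0)

/-- **`BoxAt` — the kinetic box holds on `[0,t]` with probability `→ 1`** at the kernel family `φ` (the shape of the conclusion
of `GermanoSplitLES.KineticRangeControl`, stmt-9201, under the crux prefix; stub 3 asserts it for `fineKernel`). -/
def BoxAt (σ : ℝ) (a₀ θ₀ : T3 → ℝ) (u₀ : T3 → V3) (Φ : Flows σ) (t : ℝ) (φ : ℕ → T3 → ℝ) (c Cρ C : ℝ) : Prop :=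
  Tendsto (fun N : ℕ => localGibbsLaw σ a₀ u₀ θ₀ N (Φ N)
    {z | ¬ ∀ s ∈ Icc 0 t, InBox (φ N) c Cρ C ((Φ N).flow s z)}) atTop (𝓝 0)

/-! ## §3 Proved tools of the line (sorry-free) -/

/-- Pointwise conversion: if `|u| ≤ U`, `0 ≤ θb ≤ Θ`, `0 < Θ`, `4U² ≤ K ≤ |v|²` then `(K/(4Θ))·θb ≤ |v − u|²`. -/
theorem local_level_of_abs_level {v u : V3} {K U Θ θb : ℝ} (hU0 : 0 ≤ U) (hU : ‖u‖ ≤ U)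
    (_hθ0 : 0 ≤ θb) (hθ : θb ≤ Θ) (hΘ : 0 < Θ) (hK : 4 * U ^ 2 ≤ K) (hv : K ≤ ‖v‖ ^ 2) :
    K / (4 * Θ) * θb ≤ ‖v - u‖ ^ 2 := by
  have hK0 : 0 ≤ K := le_trans (by positivity) hK
  have h1 : Real.sqrt K ≤ ‖v‖ := by
    rw [← Real.sqrt_sq (norm_nonneg v)]
    exact Real.sqrt_le_sqrt hv
  have h2 : 2 * U ≤ Real.sqrt K := by
    rw [show (2 * U) = Real.sqrt ((2 * U) ^ 2) by rw [Real.sqrt_sq (by positivity)]]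
    exact Real.sqrt_le_sqrt (by nlinarith)
  have h3 : Real.sqrt K / 2 ≤ ‖v - u‖ := by
    have := norm_sub_norm_le v u
    linarith
  have h4 : K / 4 ≤ ‖v - u‖ ^ 2 := by
    have h5 : (Real.sqrt K / 2) ^ 2 ≤ ‖v - u‖ ^ 2 := pow_le_pow_left₀ (by positivity) h3 2
    have h6 : (Real.sqrt K / 2) ^ 2 = K / 4 := by rw [div_pow, Real.sq_sqrt hK0]; ring
    linarith [h5, h6]
  have h7 : K / (4 * Θ) * θb ≤ K / 4 := by
    have h8 : K / (4 * Θ) * θb ≤ K / (4 * Θ) * Θ := mul_le_mul_of_nonneg_left hθ (by positivity)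
    calc K / (4 * Θ) * θb ≤ K / (4 * Θ) * Θ := h8
      _ = K / 4 := by field_simp
  linarith

/-- **Absolute levels are local levels inside the box** (configuration level): under the caps `U, Θ`, for every absolute
level `K ≥ 4U²`, `frac_K(w) ≤ locFrac_{K/(4Θ)}(w)`. -/
theorem frac_le_locFrac_of_box (χ : T3 → ℝ) {U Θ K : ℝ} (hU0 : 0 ≤ U) (hΘ : 0 < Θ) (hK : 4 * U ^ 2 ≤ K)
    (w : Cfg N) (hbox : BoxCaps χ U Θ w) :
    frac K w ≤ locFrac χ (K / (4 * Θ)) w := by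
  rw [frac_eq_avg, locFrac]
  refine mul_le_mul_of_nonneg_left (Finset.sum_le_sum fun i _ => ?_) (by positivity)
  by_cases h : K ≤ ‖(w i).2‖ ^ 2
  · obtain ⟨hu, hθ0, hθ⟩ := hbox (w i).1
    rw [if_pos h, if_pos (local_level_of_abs_level hU0 hu hθ0 hθ hΘ hK h)]
  · rw [if_neg h]
    split_ifs <;> norm_num

/-- **Transfer squeeze.**  If `P N ^ 2 ≤ e^{C(N+1)} · G N` for all `N` (the shape of the landed `TransferInequality`, stmt-9512)
and `G N ≤ e^{−M(N+1)}` eventually for EVERY `M` (a super-exponential equilibrium bound), then `P N → 0`. -/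
theorem tendsto_zero_of_transfer {P G : ℕ → ℝ≥0∞} (C : ℝ)
    (hdom : ∀ N, P N ^ 2 ≤ ENNReal.ofReal (Real.exp (C * ((N : ℝ) + 1))) * G N)
    (hsup : ∀ M : ℝ, ∀ᶠ N in atTop, G N ≤ ENNReal.ofReal (Real.exp (-(M * ((N : ℝ) + 1))))) :
    Tendsto P atTop (𝓝 0) := by
  have hev : ∀ᶠ N : ℕ in atTop, P N ≤ ENNReal.ofReal (Real.exp (-((N : ℝ) + 1))) := by
    filter_upwards [hsup (C + 2)] with N hN
    have hsq : P N ^ 2 ≤ (ENNReal.ofReal (Real.exp (-((N : ℝ) + 1)))) ^ 2 := by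
      calc P N ^ 2 ≤ ENNReal.ofReal (Real.exp (C * ((N : ℝ) + 1))) * G N := hdom N
        _ ≤ ENNReal.ofReal (Real.exp (C * ((N : ℝ) + 1))) *
              ENNReal.ofReal (Real.exp (-((C + 2) * ((N : ℝ) + 1)))) := by gcongr
        _ = (ENNReal.ofReal (Real.exp (-((N : ℝ) + 1)))) ^ 2 := by
              rw [← ENNReal.ofReal_mul (Real.exp_pos _).le, ← Real.exp_add,
                ← ENNReal.ofReal_pow (Real.exp_pos _).le, ← Real.exp_nat_mul]
              congr 2
              push_cast
              ring
    exact (ENNReal.pow_le_pow_left_iff two_ne_zero).1 hsq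
  have hlim : Tendsto (fun N : ℕ => ENNReal.ofReal (Real.exp (-((N : ℝ) + 1)))) atTop (𝓝 0) := by
    rw [← ENNReal.ofReal_zero]
    refine ENNReal.tendsto_ofReal (Real.tendsto_exp_atBot.comp ?_)
    exact tendsto_neg_atTop_atBot.comp (tendsto_natCast_atTop_atTop.atTop_add tendsto_const_nhds)
  exact tendsto_of_tendsto_of_tendsto_of_le_of_le' tendsto_const_nhds hlim
    (Eventually.of_forall fun _ => bot_le) hev

/-- **THE TRANSFER, PROVED: `LocalTailConcAt` from E1_loc through the landed static `L²` budget.**  For continuous positive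
profiles, with `θe := max θ₀` (compactness of `𝕋³`; then `θ₀ < 2θe`), `transferInequality_proof` (stmt-9512) gives `σ₀` and, for
`σ < σ₀`, `C` with `P_N(S)² ≤ e^{C(N+1)}·G_N(S)` for EVERY set `S`; applied to the sustained-local-excess events of E1_loc,
`tendsto_zero_of_transfer` gives `P_N → 0` at every fixed level.  (The non-equilibrium content left is nil: E1_loc is about the
invariant law, the budget is static.) -/
theorem localTailConc_of_superExp :
    ∀ (a₀ θ₀ : T3 → ℝ) (u₀ : T3 → V3), Continuous a₀ → Continuous θ₀ → Continuous u₀ →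
      (∀ x, 0 < a₀ x) → (∀ x, 0 < θ₀ x) →
      ∃ σ₀ : ℝ, 0 < σ₀ ∧ ∀ σ : ℝ, 0 < σ → σ < σ₀ →
        ∀ (Φ : (N : ℕ) → HardSphereFlow (Torus.geometry (Fin 3)) (hsDiameter σ N) (N + 1))
          (φ : ℕ → T3 → ℝ) (t c Cρ C : ℝ), 0 < t → 0 < c →
          (∀ θe : ℝ, 0 < θe → EqLocalTailSuperExp σ θe Φ φ) →
            LocalTailConcAt σ a₀ θ₀ u₀ Φ t φ c Cρ C := by
  intro a₀ θ₀ u₀ ha hθ hu ha0 hθ0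
  -- a temperature cap: `θe := θ₀ x₀` at a maximiser, so `θ₀ < 2θe`
  obtain ⟨x₀, -, hx₀⟩ := isCompact_univ.exists_isMaxOn univ_nonempty hθ.continuousOn
  have hθe : 0 < θ₀ x₀ := hθ0 x₀
  have h2 : ∀ x, θ₀ x < 2 * θ₀ x₀ := fun x => by
    have hle : θ₀ x ≤ θ₀ x₀ := isMaxOn_iff.1 hx₀ x (mem_univ x)
    linarith
  obtain ⟨σ₀, hσ₀, H⟩ := Theorems.transferInequality_proof a₀ θ₀ u₀ ha hθ hu ha0 hθ0 (θ₀ x₀) h2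
  refine ⟨σ₀, hσ₀, fun σ hσ hσlt Φ φ t c Cρ C ht hc hE a ha_pos ha_lt => ?_⟩
  obtain ⟨Ctr, hCtr⟩ := H σ hσ hσlt
  obtain ⟨A, hA⟩ := hE (θ₀ x₀) hθe c Cρ C hc a ha_pos ha_lt
  refine ⟨A, fun K hK => ?_⟩
  exact tendsto_zero_of_transfer Ctr (fun N => hCtr N (Φ N) _) (fun M => hA t K ht hK M)

/-- **Inside the box the caps hold**: `InBox χ c C_ρ C w`, `c > 0` ⟹ `BoxCaps χ (|C|/c) ((2/3)|C|/c + 1) w`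
(`‖ū‖ = ρ̄⁻¹‖m̄‖ ≤ |C|/c`; `0 < c ≤ θ̄`; `θ̄ ≤ (2/3)ē/ρ̄ ≤ (2/3)|C|/c`). -/
theorem boxCaps_of_inBox (χ : T3 → ℝ) {c Cρ C : ℝ} (hc : 0 < c) (w : Cfg N) (h : InBox χ c Cρ C w) :
    BoxCaps χ (capU c C) (capΘ c C) w := by
  intro x
  obtain ⟨h1, -, h3, h4, h5⟩ := h x
  have hρ : 0 < bρ χ w x := hc.trans_le h1
  refine ⟨?_, hc.le.trans h5, ?_⟩
  · calc ‖bu χ w x‖ = (bρ χ w x)⁻¹ * ‖bm χ w x‖ := by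
            rw [bu, norm_smul, Real.norm_eq_abs, abs_of_pos (inv_pos.2 hρ)]
        _ ≤ c⁻¹ * |C| :=
            mul_le_mul (inv_anti₀ hc h1) (h3.trans (le_abs_self C)) (norm_nonneg _) (inv_nonneg.2 hc.le)
        _ = capU c C := by rw [capU, div_eq_mul_inv, mul_comm]
  · have hsq : 0 ≤ ‖bm χ w x‖ ^ 2 / (2 * bρ χ w x ^ 2) := by positivity
    have hdiv : be χ w x / bρ χ w x ≤ |C| / c :=
      (div_le_div_of_nonneg_right (h4.trans (le_abs_self C)) hρ.le).trans
        (div_le_div_of_nonneg_left (abs_nonneg C) hc h1)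
    show 2 / 3 * (be χ w x / bρ χ w x - ‖bm χ w x‖ ^ 2 / (2 * bρ χ w x ^ 2)) ≤ 2 / 3 * (|C| / c) + 1
    linarith

/-- `locFrac_K ≤ 1`. -/
theorem locFrac_le_one (χ : T3 → ℝ) (K : ℝ) (w : Cfg N) : locFrac χ K w ≤ 1 := by
  unfold locFrac
  have hn : (0 : ℝ) < ((N + 1 : ℕ) : ℝ) := by positivity
  rw [inv_mul_le_iff₀ hn, mul_one]
  calc ∑ i : Fin (N + 1), (if K * bθ χ w (w i).1 ≤ ‖(w i).2 - bu χ w (w i).1‖ ^ 2 then (1 : ℝ) else 0)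
      ≤ ∑ _i : Fin (N + 1), (1 : ℝ) := Finset.sum_le_sum fun i _ => by split_ifs <;> norm_num
    _ = ((N + 1 : ℕ) : ℝ) := by simp

/-- A time integral over `[0, t]` of (the `ofReal` of) a function bounded by `1` is at most `t`. -/
theorem lintegral_Icc_ofReal_le_ofReal {t : ℝ} {f : ℝ → ℝ} (hf : ∀ s, f s ≤ 1) :
    ∫⁻ s in Icc 0 t, ENNReal.ofReal (f s) ≤ ENNReal.ofReal t := by
  calc ∫⁻ s in Icc 0 t, ENNReal.ofReal (f s) ≤ ∫⁻ _ in Icc (0 : ℝ) t, (1 : ℝ≥0∞) :=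
        lintegral_mono fun s => ENNReal.ofReal_le_one.2 (hf s)
    _ = ENNReal.ofReal t := by rw [setLIntegral_one, Real.volume_Icc, sub_zero]

/-- **LOCAL UNITS BACK TO ABSOLUTE UNITS ON THE BOX, PROVED.**  For any kernel family `φ`, horizon `t > 0` and box with `c > 0`:
the box w.h.p. (`BoxAt`) and the transferred local-unit concentration (`LocalTailConcAt`) give the IN-PROBABILITY SUB-GAUSSIAN
PROFILE OF THE TIME-INTEGRATED ABSOLUTE-UNIT OCCUPATIONS — verbatim the hypothesis of the dial stub 5 (= the conclusion of the
registered line's `stub_occupationInProb_of_variance`): `∃ Θ > 0, A, ∀ K, ∀ η > 0, P_N{tAe^{−K/(2Θ)} + η < occ_K} → 0`.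
No hypothesis on `φ` is used (lower integrals are monotone and outer measures subadditive without measurability).  With the caps
`U = |C|/c`, `Θ_b = (2/3)|C|/c + 1` (`boxCaps_of_inBox`), `a := 1/4`, `A` from `LocalTailConcAt`, output `Θ := 8Θ_b`,
`A_out := max A 0 + e^{U²/(4Θ_b)}`: levels `K ≤ 4U²` give an EMPTY event (`occ_K ≤ t ≤ tA_out e^{−K/(16Θ_b)}`); levels `K > 4U²`
give `occ_K ≤ locOcc_{K/(4Θ_b)}` on the box (`frac_le_locFrac_of_box` at every `s ≤ t`), so the event lies in
`{¬box} ∪ {box ∧ tAe^{−K/(16Θ_b)} < locOcc_{K/(4Θ_b)}}`, both of probability `→ 0`. -/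
theorem occupationInProb_of_localTailConc :
    ∀ (σ : ℝ) (a₀ θ₀ : T3 → ℝ) (u₀ : T3 → V3)
      (Φ : (N : ℕ) → HardSphereFlow (Torus.geometry (Fin 3)) (hsDiameter σ N) (N + 1)) (t : ℝ)
      (φ : ℕ → T3 → ℝ) (c Cρ C : ℝ), 0 < t → 0 < c →
      BoxAt σ a₀ θ₀ u₀ Φ t φ c Cρ C → LocalTailConcAt σ a₀ θ₀ u₀ Φ t φ c Cρ C →
        ∃ Θ A : ℝ, 0 < Θ ∧ ∀ K : ℝ, ∀ η : ℝ, 0 < η →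
          Tendsto (fun N : ℕ => localGibbsLaw σ a₀ u₀ θ₀ N (Φ N)
            {z | t * A * Real.exp (-(K / (2 * Θ))) + η <
              (∫⁻ s in Icc 0 t, ENNReal.ofReal (frac K ((Φ N).flow s z))).toReal}) atTop (𝓝 0) := by
  intro σ a₀ θ₀ u₀ Φ t φ c Cρ C ht hc hBox hLoc
  have hBox' : Tendsto (fun N : ℕ => localGibbsLaw σ a₀ u₀ θ₀ N (Φ N)
      {z | ¬ ∀ s ∈ Icc 0 t, InBox (φ N) c Cρ C ((Φ N).flow s z)}) atTop (𝓝 0) := hBox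
  obtain ⟨A, hA⟩ := hLoc (1 / 4) (by norm_num) (by norm_num)
  have hU0 : 0 ≤ capU c C := capU_nonneg C hc
  have hΘ0 : 0 < capΘ c C := capΘ_pos C hc
  set Aout : ℝ := max A 0 + Real.exp (capU c C ^ 2 / (4 * capΘ c C)) with hAout
  have hAle : A ≤ Aout := (le_max_left A 0).trans (le_add_of_nonneg_right (Real.exp_pos _).le)
  have hAexp : Real.exp (capU c C ^ 2 / (4 * capΘ c C)) ≤ Aout := le_add_of_nonneg_left (le_max_right A 0)
  refine ⟨8 * capΘ c C, Aout, by positivity, fun K η hη => ?_⟩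
  -- occupations are at most `t`
  have hocc_le : ∀ (N : ℕ) (z : Cfg N),
      (∫⁻ s in Icc 0 t, ENNReal.ofReal (frac K ((Φ N).flow s z))).toReal ≤ t := fun N z =>
    ENNReal.toReal_le_of_le_ofReal ht.le (lintegral_Icc_ofReal_le_ofReal fun s => (frac_mem_Icc K _).2)
  by_cases hK : 4 * capU c C ^ 2 < K
  · -- levels above `4U²`: the local level `K' = K/(4Θ_b)` is positive
    have hK' : 0 < K / (4 * capΘ c C) := div_pos (lt_of_le_of_lt (by positivity) hK) (by positivity)
    have hE : Real.exp (-(1 / 4 * (K / (4 * capΘ c C)))) = Real.exp (-(K / (2 * (8 * capΘ c C)))) := by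
      congr 1
      ring
    have hsub : ∀ N : ℕ,
        {z : Cfg N | t * Aout * Real.exp (-(K / (2 * (8 * capΘ c C)))) + η <
            (∫⁻ s in Icc 0 t, ENNReal.ofReal (frac K ((Φ N).flow s z))).toReal} ⊆
          {z | ¬ ∀ s ∈ Icc 0 t, InBox (φ N) c Cρ C ((Φ N).flow s z)} ∪
          {z | (∀ s ∈ Icc 0 t, InBox (φ N) c Cρ C ((Φ N).flow s z)) ∧
            t * A * Real.exp (-(1 / 4 * (K / (4 * capΘ c C)))) <
              (∫⁻ s in Icc 0 t, ENNReal.ofReal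
                (locFrac (φ N) (K / (4 * capΘ c C)) ((Φ N).flow s z))).toReal} := by
      intro N z hz
      simp only [Set.mem_setOf_eq, Set.mem_union] at hz ⊢
      by_cases hbox : ∀ s ∈ Icc 0 t, InBox (φ N) c Cρ C ((Φ N).flow s z)
      · refine Or.inr ⟨hbox, ?_⟩
        have hmono : (∫⁻ s in Icc 0 t, ENNReal.ofReal (frac K ((Φ N).flow s z))).toReal ≤
            (∫⁻ s in Icc 0 t, ENNReal.ofReal
              (locFrac (φ N) (K / (4 * capΘ c C)) ((Φ N).flow s z))).toReal := by
          refine ENNReal.toReal_mono ?_ (setLIntegral_mono' measurableSet_Icc fun s hs => ?_)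
          · exact ne_top_of_le_ne_top ENNReal.ofReal_ne_top
              (lintegral_Icc_ofReal_le_ofReal fun s => locFrac_le_one _ _ _)
          · exact ENNReal.ofReal_le_ofReal (frac_le_locFrac_of_box (φ N) hU0 hΘ0 hK.le _
              (boxCaps_of_inBox (φ N) hc _ (hbox s hs)))
        have hthr : t * A * Real.exp (-(1 / 4 * (K / (4 * capΘ c C)))) ≤
            t * Aout * Real.exp (-(K / (2 * (8 * capΘ c C)))) := by
          rw [hE]
          exact mul_le_mul_of_nonneg_right (mul_le_mul_of_nonneg_left hAle ht.le) (Real.exp_pos _).le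
        linarith
      · exact Or.inl hbox
    have hlim : Tendsto (fun N : ℕ =>
        localGibbsLaw σ a₀ u₀ θ₀ N (Φ N) {z | ¬ ∀ s ∈ Icc 0 t, InBox (φ N) c Cρ C ((Φ N).flow s z)} +
        localGibbsLaw σ a₀ u₀ θ₀ N (Φ N) {z | (∀ s ∈ Icc 0 t, InBox (φ N) c Cρ C ((Φ N).flow s z)) ∧
            t * A * Real.exp (-(1 / 4 * (K / (4 * capΘ c C)))) <
              (∫⁻ s in Icc 0 t, ENNReal.ofReal
                (locFrac (φ N) (K / (4 * capΘ c C)) ((Φ N).flow s z))).toReal})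
        atTop (𝓝 0) := by
      simpa using hBox'.add (hA (K / (4 * capΘ c C)) hK')
    exact tendsto_of_tendsto_of_tendsto_of_le_of_le tendsto_const_nhds hlim (fun N => bot_le)
      fun N => (measure_mono (hsub N)).trans (measure_union_le _ _)
  · -- levels `K ≤ 4U²`: the event is EMPTY (`occ_K ≤ t ≤ t·A_out·e^{−K/(16Θ_b)}`)
    have hK : K ≤ 4 * capU c C ^ 2 := le_of_not_gt hK
    have hone : 1 ≤ Aout * Real.exp (-(K / (2 * (8 * capΘ c C)))) := by
      have h16 : K / (2 * (8 * capΘ c C)) ≤ 4 * capU c C ^ 2 / (2 * (8 * capΘ c C)) :=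
        div_le_div_of_nonneg_right hK (by positivity)
      have heq : capU c C ^ 2 / (4 * capΘ c C) = 4 * capU c C ^ 2 / (2 * (8 * capΘ c C)) := by ring
      have harg : 0 ≤ capU c C ^ 2 / (4 * capΘ c C) + -(K / (2 * (8 * capΘ c C))) := by linarith
      have h1 : 1 ≤ Real.exp (capU c C ^ 2 / (4 * capΘ c C)) * Real.exp (-(K / (2 * (8 * capΘ c C)))) := by
        rw [← Real.exp_add]
        linarith [Real.add_one_le_exp (capU c C ^ 2 / (4 * capΘ c C) + -(K / (2 * (8 * capΘ c C))))]
      exact h1.trans (mul_le_mul_of_nonneg_right hAexp (Real.exp_pos _).le)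
    have hsub0 : ∀ N : ℕ,
        {z : Cfg N | t * Aout * Real.exp (-(K / (2 * (8 * capΘ c C)))) + η <
            (∫⁻ s in Icc 0 t, ENNReal.ofReal (frac K ((Φ N).flow s z))).toReal} ⊆ (∅ : Set (Cfg N)) := by
      intro N z hz
      simp only [Set.mem_setOf_eq, Set.mem_empty_iff_false] at hz ⊢
      have h1 := hocc_le N z
      have h2 : t ≤ t * Aout * Real.exp (-(K / (2 * (8 * capΘ c C)))) := by
        have h := mul_le_mul_of_nonneg_left hone ht.le
        rwa [mul_one, ← mul_assoc] at h
      linarith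
    exact tendsto_of_tendsto_of_tendsto_of_le_of_le tendsto_const_nhds tendsto_const_nhds (fun N => bot_le)
      fun N => (measure_mono (hsub0 N)).trans (le_of_eq measure_empty)

/-! ## §4 Registered stubs (bodies `sorry`)

Every signature is self-contained over LANDED vocabulary (`frac` from `…AprioriBoundsFibreDefs`, `FarTailAllAt` from `…FibreDefsR4`,
`PartOneAt`/`PartTwoAt` from `…Negative.EquilibriumRung`, `NiceProfiles` from `…VisitLedgerDefs`, `Torus.kernel` from
`Literature.Analysis.FunctionSpaces.TorusMollifier`) and the §1–§2 definitions of THIS file.  Stubs 1, 2, 5 are BYTE-IDENTICAL to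
the registered line `tail-occupation-variance` (one registered obligation serves both lines). -/

namespace Holds

/-- STUB 1 `cellBounds` (OPEN — component (ii) VERBATIM under the crux prefix; an IMPORT docked to
`GermanoSplitLES.KineticRangeControl` (stmt-9201) by the landed glue `AdiabatCeiling.partTwo_of_kineticRangeControl`).
Byte-identical to the registered lines' `stub_cellBounds` (one registered obligation serves all lines). -/
theorem stub_cellBounds :
    ∀ (a₀ θ₀ : T3 → ℝ) (u₀ : T3 → V3), Continuous a₀ → Continuous θ₀ → Continuous u₀ →
      (∀ x, 0 < a₀ x) → (∀ x, 0 < θ₀ x) →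
      ∃ σ₀ : ℝ, 0 < σ₀ ∧ ∃ η₁ : ℝ, 0 < η₁ ∧ ∀ σ : ℝ, 0 < σ → σ < σ₀ →
        ∀ (T : ℝ) (ρ θ : ℝ → T3 → ℝ) (u : ℝ → T3 → V3), IsHardSphereEulerSolution σ T ρ u θ →
        ∀ Φ : (N : ℕ) → HardSphereFlow (Torus.geometry (Fin 3)) (hsDiameter σ N) (N + 1),
          TendstoHydroFieldsAt (fun N => localGibbsLaw σ a₀ u₀ θ₀ N (Φ N)) Φ ρ u θ 0 →
          ∀ t : ℝ, 0 < t → t < T → (∀ s ∈ Icc 0 t, ∀ x, 2 * ρ s x * σ ^ 3 < η₁) →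
            PartTwoAt σ a₀ θ₀ u₀ Φ t := by
  sorry

/-- STUB 2 `farTailAll` (OPEN — the SIZE input: far tails at ALL levels in the MEAN, `FarTailAllAt`:
`E_N ∫₀ᵗ frac_K ds ≤ t·A·e^{−K/(2Θ)}` eventually in `N`, for all `K`).  Producer: the PRE-SHOCK tail item
`UGibbsSRBRigidity.GaussianTails` (stmt-14415) through the landed Markov–Tonelli glue `farTailAll_of_gaussianTails`
(p137042).  Byte-identical to the registered lines' `stub_farTailAll`. -/
theorem stub_farTailAll :
    ∀ (a₀ θ₀ : T3 → ℝ) (u₀ : T3 → V3), Continuous a₀ → Continuous θ₀ → Continuous u₀ →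
      (∀ x, 0 < a₀ x) → (∀ x, 0 < θ₀ x) →
      ∃ σ₀ : ℝ, 0 < σ₀ ∧ ∃ η₁ : ℝ, 0 < η₁ ∧ ∀ σ : ℝ, 0 < σ → σ < σ₀ →
        ∀ (T : ℝ) (ρ θ : ℝ → T3 → ℝ) (u : ℝ → T3 → V3), IsHardSphereEulerSolution σ T ρ u θ →
        ∀ Φ : (N : ℕ) → HardSphereFlow (Torus.geometry (Fin 3)) (hsDiameter σ N) (N + 1),
          TendstoHydroFieldsAt (fun N => localGibbsLaw σ a₀ u₀ θ₀ N (Φ N)) Φ ρ u θ 0 →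
          ∀ t : ℝ, 0 < t → t < T → (∀ s ∈ Icc 0 t, ∀ x, 2 * ρ s x * σ ^ 3 < η₁) →
            FarTailAllAt σ a₀ θ₀ u₀ Φ t := by
  sorry

/-- STUB 3 `boxFine` (OPEN — IMPORT: the kinetic box at the FINE admissible filter `(N+1)^{-1/4}` under the crux prefix).
For the fine kernel family there are `0 < c`, `C_ρ`, `C` with `P_N{¬ box on [0,t]} → 0`.  Producer:
`GermanoSplitLES.KineticRangeControl` (stmt-9201, XL, open) — it is typed for EVERY admissible kinetic filter
`ℓ_N → 0, (N+1)ℓ_N³/log(N+2) → ∞`, so `ℓ_N = (N+1)^{-1/4}` qualifies; glue = the landed `partTwo_of_kineticRangeControl`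
nearly verbatim (`η₀ := 1`, `η₁ := 2`, `exists_chamber_extension`, `IsHardSphereEulerSolution.restrict`, the REFLECTED family
`y ↦ fineKernel N (−y)` with `A := 2C`, `(N+1)^{1−3/4}/log(N+2) → ∞`), keeping KRC's box event instead of reading a floor/ceiling
out of it (`InBox` is KRC's box with KRC's `θ̄`; `fineKernel N (−(x − y)) = fineKernel N (y − x)`).  Recorded as its OWN stub
(triage r2-2 (2)): this is the finest use of 9201 on the board (blocks of `N^{1/4}` spheres); if 9201 is ever narrowed to coarse
filters, THIS stub is what the line loses. -/
theorem stub_boxFine :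
    ∀ (a₀ θ₀ : T3 → ℝ) (u₀ : T3 → V3), Continuous a₀ → Continuous θ₀ → Continuous u₀ →
      (∀ x, 0 < a₀ x) → (∀ x, 0 < θ₀ x) →
      ∃ σ₀ : ℝ, 0 < σ₀ ∧ ∃ η₁ : ℝ, 0 < η₁ ∧ ∀ σ : ℝ, 0 < σ → σ < σ₀ →
        ∀ (T : ℝ) (ρ θ : ℝ → T3 → ℝ) (u : ℝ → T3 → V3), IsHardSphereEulerSolution σ T ρ u θ →
        ∀ Φ : (N : ℕ) → HardSphereFlow (Torus.geometry (Fin 3)) (hsDiameter σ N) (N + 1),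
          TendstoHydroFieldsAt (fun N => localGibbsLaw σ a₀ u₀ θ₀ N (Φ N)) Φ ρ u θ 0 →
          ∀ t : ℝ, 0 < t → t < T → (∀ s ∈ Icc 0 t, ∀ x, 2 * ρ s x * σ ^ 3 < η₁) →
            ∃ c Cρ C : ℝ, 0 < c ∧ BoxAt σ a₀ θ₀ u₀ Φ t fineKernel c Cρ C := by
  sorry

/-- STUB 4 `eqLocalTailSuperExp` = E1_loc (OPEN — THE LOAD-BEARING, EQUILIBRIUM-ONLY STUB).  For some `σ₀ > 0`, every
`0 < σ < σ₀`, every temperature `θe > 0` and every flow family: `EqLocalTailSuperExp σ θe Φ fineKernel` — under the INVARIANT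
homogeneous hard-sphere Gibbs law, a SUSTAINED (time-integrated over `[0,t]`) excess of the LOCAL-unit tail fraction at a FIXED
level `K > 0` above the envelope `A e^{−aK}` (`a < 1/2`), while the kinetic box holds, has probability `≤ e^{−M(N+1)}` for every `M`,
eventually in `N`.  Why plausibly true: in local units neither jets (`ū`) nor hot spots (`θ̄`) nor density/temperature profile
deviations register (the `e^{O(N)}`-cost directions are factored out by self-normalisation); what remains is an atypical velocity
SHAPE of an EXTENSIVE population (`≍ Ne^{−K/2}` spheres at fixed `K`) maintained through `σ²(N+1)^{1/3}t → ∞` collision refreshes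
per sphere — a space-TIME extensive conspiracy; the census of `O(N)`-cost equilibrium structures that could sustain a local-unit
excess with the box holding (card + TRIAGE-r1-3 + r2-1 + r2-2: sub-filter hot lattices die in `σ²N^{1/3−2γ'} → 0` iff `γ' > 1/6`,
`ℓ`-collars of persistent `N^{-1/6}` structures have volume fraction `N^{1/6−γ'} → 0`, shocks straddle a fraction `N^{-γ'}`,
counter-streams stay inside the envelope for `a ≤ 0.49` and relax in `N^{-1/3}/σ²`, collisionless lanes cost `Θ(N log N)`) found
none.  TRUE-in-kind unit test: at each FIXED time the velocities under `G_N` are i.i.d. Maxwellian given the positions, so the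
typical value of `locFrac_K` is `P(χ²₃ ≥ K)(1 + o(1)) < A e^{−aK}` once `A > sup_K P(χ²₃ ≥ K)e^{aK}` (= 1.68 at `a = 0.45`, r2-2 (A)).
Why it might fail: it is a uniform-in-`N` SUPER-exponential occupation-time large-deviation bound for the DETERMINISTIC equilibrium
hard-sphere flow — `BoltzmannHypothesis`/`MacroErgodicity` class, the open-problem family of
`SuperextensiveClosureCost.MomentumClosureCost` (stmt-14424) and of crux 12950 line A; FALSE at `σ = 0` (free flight), so the
`0 < σ` binder is load-bearing; no tool in print (Kifer 1990 / Young 1990 occupation LDPs need hyperbolicity; the BGSS `L²`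
framework is Boltzmann–Grad). -/
theorem stub_eqLocalTailSuperExp :
    ∃ σ₀ : ℝ, 0 < σ₀ ∧ ∀ σ : ℝ, 0 < σ → σ < σ₀ → ∀ θe : ℝ, 0 < θe →
      ∀ Φ : (N : ℕ) → HardSphereFlow (Torus.geometry (Fin 3)) (hsDiameter σ N) (N + 1),
        EqLocalTailSuperExp σ θe Φ fineKernel := by
  sorry

/-- STUB 5 `partOne_of_occupation` (PROVABLE NOW, M–L — the dial; BYTE-IDENTICAL to the registered line `tail-occupation-variance`'s
stub 5, one obligation for both lines).  For `0 < σ ≤ 1/2`, nice profiles, `t > 0`: the in-probability Gaussian profile of the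
occupations (constants `Θ', A'`; here the output of the PROVED `occupationInProb_of_localTailConc`) and `FarTailAllAt` (constants
`Θ, A`) give `PartOneAt`.  Plan:
`λ := 1/(4 max(Θ,Θ'))`; layer cake over integer levels, `(N+1)⁻¹∑ᵢ e^{λ|vᵢ|²} ≤ ∑_{K∈ℕ} e^{λ(K+1)} frac_K`, so by Tonelli
`∫₀ᵗ(N+1)⁻¹∑ᵢe^{λ|vᵢ(s)|²}ds ≤ ∑_K e^{λ(K+1)} occ_K` on good orbits; `C_λ := ∑_K e^{λ(K+1)}·tA'e^{−K/(2Θ')}` (geometric),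
`Cexp := C_λ + 1`.  Given `ε > 0` pick a level cut `M` with `2∑_{K>M} e^{λ(K+1)} tAe^{−K/(2Θ)} ≤ ε/2`; Markov on the top
(`FarTailAllAt`, `N ≥ N₀`): `P{∑_{K>M} e^{λ(K+1)}occ_K > 1/2} ≤ ε/2`; on the levels `K ≤ M` use stub 4 with
`η_K := e^{−λ(K+1)}/(2(M+1))` (stub 4 = the in-probability profile hypothesis): off the union of the `M+1` bad events
`∑_{K≤M} e^{λ(K+1)} occ_K ≤ C_λ + 1/2`.  Hence `P{Cexp < ∫₀ᵗ…} ≤ ∑_{K≤M} P(bad_K) + ε/2`, `limsup ≤ ε/2` for every `ε`.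
Template: the landed `Theorems.FibreDeficitTransfer.stub_partOnePrime` / `partOne_markov_step` (tools
`pp_sum_range_exp_mul_exp_neg_le`, `pp_lintegral_orbit_expAvg_le`, `measure_timeAvg_gt_le_of_trunc`). -/
theorem stub_partOne_of_occupation :
    ∀ (σ : ℝ) (a₀ θ₀ : T3 → ℝ) (u₀ : T3 → V3)
      (Φ : (N : ℕ) → HardSphereFlow (Torus.geometry (Fin 3)) (hsDiameter σ N) (N + 1)) (t : ℝ),
      0 < σ → σ ≤ 1 / 2 → NiceProfiles a₀ θ₀ u₀ → 0 < t →
      (∃ Θ A : ℝ, 0 < Θ ∧ ∀ K : ℝ, ∀ η : ℝ, 0 < η →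
          Tendsto (fun N : ℕ => localGibbsLaw σ a₀ u₀ θ₀ N (Φ N)
            {z | t * A * Real.exp (-(K / (2 * Θ))) + η <
              (∫⁻ s in Icc 0 t, ENNReal.ofReal (frac K ((Φ N).flow s z))).toReal}) atTop (𝓝 0)) →
      FarTailAllAt σ a₀ θ₀ u₀ Φ t → PartOneAt σ a₀ θ₀ u₀ Φ t := by
  sorry

end Holds

/-! ## §5 Stub statements by name -/

/-- Statement of registered stub 1 (`Holds.stub_cellBounds`). -/
def stub_cellBounds : Prop := type_of% Holds.stub_cellBounds
/-- Statement of registered stub 2 (`Holds.stub_farTailAll`). -/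
def stub_farTailAll : Prop := type_of% Holds.stub_farTailAll
/-- Statement of registered stub 3 (`Holds.stub_boxFine`). -/
def stub_boxFine : Prop := type_of% Holds.stub_boxFine
/-- Statement of registered stub 4 (`Holds.stub_eqLocalTailSuperExp`). -/
def stub_eqLocalTailSuperExp : Prop := type_of% Holds.stub_eqLocalTailSuperExp
/-- Statement of registered stub 5 (`Holds.stub_partOne_of_occupation`). -/
def stub_partOne_of_occupation : Prop := type_of% Holds.stub_partOne_of_occupation

/-! ## §6 Compositions (sorry-free) -/

/-- **Component (i) under the crux prefix** from stubs 2 (size), 3 (fine box), 4 (E1_loc), 5 (dial) and the PROVED transfer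
`localTailConc_of_superExp` and units conversion `occupationInProb_of_localTailConc`:
`σ₀ := min (min (min σ₂ σ₃) (min σ₄ σ₅)) (1/2)`, `η₁ := min η₂ η₃`. -/
theorem partOne_of (h2 : stub_farTailAll) (h3 : stub_boxFine) (h4 : stub_eqLocalTailSuperExp)
    (h6 : stub_partOne_of_occupation) :
    ∀ (a₀ θ₀ : T3 → ℝ) (u₀ : T3 → V3), Continuous a₀ → Continuous θ₀ → Continuous u₀ →
      (∀ x, 0 < a₀ x) → (∀ x, 0 < θ₀ x) →
      ∃ σ₀ : ℝ, 0 < σ₀ ∧ ∃ η₁ : ℝ, 0 < η₁ ∧ ∀ σ : ℝ, 0 < σ → σ < σ₀ →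
        ∀ (T : ℝ) (ρ θ : ℝ → T3 → ℝ) (u : ℝ → T3 → V3), IsHardSphereEulerSolution σ T ρ u θ →
        ∀ Φ : (N : ℕ) → HardSphereFlow (Torus.geometry (Fin 3)) (hsDiameter σ N) (N + 1),
          TendstoHydroFieldsAt (fun N => localGibbsLaw σ a₀ u₀ θ₀ N (Φ N)) Φ ρ u θ 0 →
          ∀ t : ℝ, 0 < t → t < T → (∀ s ∈ Icc 0 t, ∀ x, 2 * ρ s x * σ ^ 3 < η₁) →
            PartOneAt σ a₀ θ₀ u₀ Φ t := by
  intro a₀ θ₀ u₀ ha hθ hu ha0 hθ0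
  have hP : NiceProfiles a₀ θ₀ u₀ := ⟨ha, hθ, hu, ha0, hθ0⟩
  obtain ⟨σ₂, hσ₂, η₂, hη₂, H2⟩ := (h2 : type_of% Holds.stub_farTailAll) a₀ θ₀ u₀ ha hθ hu ha0 hθ0
  obtain ⟨σ₃, hσ₃, η₃, hη₃, H3⟩ := (h3 : type_of% Holds.stub_boxFine) a₀ θ₀ u₀ ha hθ hu ha0 hθ0
  obtain ⟨σ₄, hσ₄, H4⟩ := (h4 : type_of% Holds.stub_eqLocalTailSuperExp)
  obtain ⟨σ₅, hσ₅, H5⟩ := localTailConc_of_superExp a₀ θ₀ u₀ ha hθ hu ha0 hθ0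
  have H7 : type_of% Holds.stub_partOne_of_occupation := h6
  refine ⟨min (min (min σ₂ σ₃) (min σ₄ σ₅)) (1 / 2),
    lt_min (lt_min (lt_min hσ₂ hσ₃) (lt_min hσ₄ hσ₅)) one_half_pos, min η₂ η₃, lt_min hη₂ hη₃, ?_⟩
  intro σ hσ hσlt T ρ θ u hsol Φ hLLN t ht htT hdil
  simp only [lt_min_iff] at hσlt hdil
  obtain ⟨⟨⟨hs2, hs3⟩, ⟨hs4, hs5⟩⟩, hshalf⟩ := hσlt
  have hFar : FarTailAllAt σ a₀ θ₀ u₀ Φ t :=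
    H2 σ hσ hs2 T ρ θ u hsol Φ hLLN t ht htT (fun s hs x => (hdil s hs x).1)
  obtain ⟨c, Cρ, C, hc, hBox⟩ :=
    H3 σ hσ hs3 T ρ θ u hsol Φ hLLN t ht htT (fun s hs x => (hdil s hs x).2)
  have hE : ∀ θe : ℝ, 0 < θe → EqLocalTailSuperExp σ θe Φ fineKernel := fun θe hθe =>
    H4 σ hσ hs4 θe hθe Φ
  have hLoc : LocalTailConcAt σ a₀ θ₀ u₀ Φ t fineKernel c Cρ C :=
    H5 σ hσ hs5 Φ fineKernel t c Cρ C ht hc hE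
  have hOcc := occupationInProb_of_localTailConc σ a₀ θ₀ u₀ Φ t fineKernel c Cρ C ht hc hBox hLoc
  exact H7 σ a₀ θ₀ u₀ Φ t hσ hshalf.le hP ht hOcc hFar

/-- **THE SKELETON THEOREM (r1).**  The five registered stubs (1 `cellBounds`, 2 `farTailAll`, 3 `boxFine`, 4 `eqLocalTailSuperExp`
OPEN; 5 `partOne_of_occupation` provable now) imply the crux decl `StiffCollisionalRelaxation.AprioriBounds` BY NAME; the transfer
and the units conversion are PROVED in this file. -/
theorem AprioriBounds_of (h1 : stub_cellBounds) (h2 : stub_farTailAll) (h3 : stub_boxFine)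
    (h4 : stub_eqLocalTailSuperExp) (h6 : stub_partOne_of_occupation) :
    Summit.AtomisticToContinuum.HydrodynamicLimit.Theses.StiffCollisionalRelaxation.AprioriBounds := by
  rw [Theorems.AprioriBoundsNegative.aprioriBounds_iff]
  intro a₀ θ₀ u₀ ha hθ hu ha0 hθ0
  obtain ⟨σ₁, hσ₁, η₁', hη₁', HI⟩ := partOne_of h2 h3 h4 h6 a₀ θ₀ u₀ ha hθ hu ha0 hθ0
  obtain ⟨σ₂, hσ₂, η₂', hη₂', HII⟩ := (h1 : type_of% Holds.stub_cellBounds) a₀ θ₀ u₀ ha hθ hu ha0 hθ0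
  refine ⟨min σ₁ σ₂, lt_min hσ₁ hσ₂, min η₁' η₂', lt_min hη₁' hη₂', ?_⟩
  intro σ hσ hσlt T ρ θ u hsol Φ hLLN t ht htT hdil
  simp only [lt_min_iff] at hσlt hdil
  exact ⟨HI σ hσ hσlt.1 T ρ θ u hsol Φ hLLN t ht htT (fun s hs x => (hdil s hs x).1),
    HII σ hσ hσlt.2 T ρ θ u hsol Φ hLLN t ht htT (fun s hs x => (hdil s hs x).2)⟩

/-- The same skeleton closes the `CollisionIsometryCLT` copy of the crux (one `Prop`). -/
theorem AprioriBoundsPreShock_of (h1 : stub_cellBounds) (h2 : stub_farTailAll) (h3 : stub_boxFine)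
    (h4 : stub_eqLocalTailSuperExp) (h6 : stub_partOne_of_occupation) :
    Summit.AtomisticToContinuum.HydrodynamicLimit.Theses.CollisionIsometryCLT.AprioriBoundsPreShock :=
  AprioriBounds_of h1 h2 h3 h4 h6

/-- D-0027 §3.3 shape: the crux from the registered stubs. -/
example : Summit.AtomisticToContinuum.HydrodynamicLimit.Theses.StiffCollisionalRelaxation.AprioriBounds :=
  AprioriBounds_of Holds.stub_cellBounds Holds.stub_farTailAll Holds.stub_boxFine Holds.stub_eqLocalTailSuperExp
    Holds.stub_partOne_of_occupation

end Summit.AtomisticToContinuum.HydrodynamicLimit.Cruxes.AprioriBounds.LocalUnitsOnTheKineticBox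

end
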